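import Summits.ValiantsHypothesis.ValiantsHypothesis.Theorems.KPlusLogSqLawTropicalGradedWalkDomXGlue1

/-!
# Dominance glue (type X), part 6: the block columns `u + 2 ≤ b < w`

GRW-lite `K = 4` graded-walk family (census side of the tropical root law, all `m`):
dominance glue for the EXCURSION states `(w, u, 1)`, `2 ≤ u ≤ w − 1 < m − 1`, of the design typed in
`KPlusLogSqLawTropicalGradedWalkDefs` (Leibniz term: the diagonal term of `(w, u, 0)` with the rows of the columns
`u − 1`, `u` exchanged).  This part dispatches an arbitrary rival `(a, b, l)` of a block column `b ≥ u + 2`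
(intended incidence: row `m − w + b`, class `1`, level `w`, bend `SXL b`) to its slack family of `…DomX4` – `…DomX10`
(far rivals are first reduced to the best class of their level by the generic lifts of `…GradedWalkLift`).

Honest framing: this is a census-side (lower-bound) construction — a quadratic family of
distinct optimal slopes for `TropRootLawAt (n+1) 4`.  It says nothing about `TropicalB` inside
its window and nothing about VP ≠ VNP.
-/

set_option linter.dupNamespace false
set_option autoImplicit false

namespace Summit.ValiantsHypothesis.ValiantsHypothesis.Theorems.LacunarySymmetroidMatrixDescartes.TropicalCensus

namespace GradedWalk

open Summit.ValiantsHypothesis.ValiantsHypothesis.Theorems.MatrixDescartes.Negative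

variable (n : ℕ)

/-! ### slack, the block columns `u + 2 ≤ b < w` -/

/-- the intended incidence of a column `b ≥ u + 2` and its potential. -/
theorem interfaceX_ge (w u : ℕ) (hu2 : 2 ≤ u) (huw : u < w) (hwn : w ≤ n) (b : Fin (n + 1))
    (hub : u + 2 ≤ (b : ℕ)) (hbw : (b : ℕ) < w) :
    ((perm n w u 1 b : Fin (n + 1)) : ℕ) = (b : ℕ) + (n + 1 - w) ∧
    (lam n w u 1 b = 1) ∧
    (thX n w u * (dd n 1 : ℤ) - vv n (perm n w u 1 b) b 1 = thX n w u * d1 n - v1 n (w) ((b : ℕ))) ∧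
    (UX n w u ((perm n w u 1 b : Fin (n + 1)) : ℕ) = gG n * thX n w u * (((n + 1 - w + ((b : ℕ))) : ℕ) : ℤ) + SXL n w u ((b : ℕ))) := by
  have hw1 : w ≤ n + 1 := by omega
  have hr : ((perm n w u 1 b : Fin (n + 1)) : ℕ) = (b : ℕ) + (n + 1 - w) := sigmaX_blk n huw hw1 b hbw (by omega) (by omega)
  have hlowr : (b : ℕ) < ((perm n w u 1 b : Fin (n + 1)) : ℕ) := by rw [hr]; omega
  refine ⟨hr, ?_, ?_, ?_⟩
  · rw [lam_X n huw, if_neg (show ¬ w ≤ (b : ℕ) by omega), if_neg (show ¬ ((b : ℕ) + 1 < u) by omega),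
      if_neg (show ¬ ((b : ℕ) < u) by omega)]
  · rw [dd_cast_one, vv_lower n hlowr, hr, show n + 1 + (b : ℕ) - ((b : ℕ) + (n + 1 - w)) = w by omega, vblk_one]
  · rw [hr]; unfold UX; rw [show (b : ℕ) + (n + 1 - w) - (n + 1 - w) = (b : ℕ) by omega, muX_ge n hub,
      show (b : ℕ) + (n + 1 - w) = n + 1 - w + (b : ℕ) by omega]

set_option maxHeartbeats 400000 in
/-- slack of the type-X certificate: block columns `b ≥ u + 2`, rival rows above the diagonal (wrap cells). -/
theorem slackX_ge_up (w u : ℕ) (hu2 : 2 ≤ u) (huw : u < w) (hwn : w ≤ n) (a b : Fin (n + 1)) (l : Fin 4)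
    (hp : ee n a b l ≠ 0) (hub : u + 2 ≤ (b : ℕ)) (hbw : (b : ℕ) < w) (hab : (a : ℕ) < (b : ℕ)) :
    1 * (thX n w u * (dd n l : ℤ) - vv n a b l) <
      UX n w u a + ((thX n w u * (dd n (lam n w u 1 b) : ℤ) - vv n (perm n w u 1 b) b (lam n w u 1 b)) - UX n w u (perm n w u 1 b)) := by
  have hw1 : w ≤ n + 1 := by omega
  have hbw1 : (b : ℕ) + 1 ≤ w := by omega
  obtain ⟨hr, hlam, hT1, hUr⟩ := interfaceX_ge n w u hu2 huw hwn b hub hbw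
  rw [hlam]
  have hl : l = 0 ∨ l = 1 := by
    rcases (show l = 0 ∨ l = 1 ∨ l = 2 ∨ l = 3 by fin_cases l <;> simp) with rfl | rfl | rfl | rfl
    · exact Or.inl rfl
    · exact Or.inr rfl
    · exact absurd (ee_upper_ge_two n hab 2 (by decide)) hp
    · exact absurd (ee_upper_ge_two n hab 3 (by decide)) hp
  -- the two rival classes share the row analysis; `hXg l' x` names the rival's reduced weight
  have hX0g : ∀ x : ℕ, (a : ℕ) = x → thX n w u * (dd n 0 : ℤ) - vv n a b 0 = ((0 : ℤ) - 4 * mZ n * gG n ^ 2 * (((((b : ℕ)) - (x)) : ℕ) : ℤ) ^ 2) := by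
    intro x hx
    have hc : ((((((b : ℕ))) - (x) : ℕ)) : ℤ) = (((b : ℕ)) : ℤ) - (((a : ℕ)) : ℤ) := by
      rw [hx]; push_cast [Nat.cast_sub (show x ≤ (b : ℕ) by omega)]; ring
    rw [dd_cast_zero, vv_upper_zero n hab, hc]; ring
  have hX1g : ∀ x : ℕ, (a : ℕ) = x → thX n w u * (dd n 1 : ℤ) - vv n a b 1 = (thX n w u * d1 n - conn n ((((b : ℕ))) - (x)) (((b : ℕ)))) := by
    intro x hx
    rw [dd_cast_one, vv_upper_one n hab, hx]
  -- potential differences by row regime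
  rcases Nat.eq_zero_or_pos (a : ℕ) with ha0 | ha0
  · have hY : UX n w u a - UX n w u ((perm n w u 1 b : Fin (n + 1)) : ℕ) = ((0 : ℤ) - (gG n * thX n w u * (((n + 1 - w + ((b : ℕ))) : ℕ) : ℤ) + SXL n w u ((b : ℕ)))) := by
      rw [hUr]; unfold UX; rw [ha0, Nat.zero_sub, muX_zero n hu2]; simp
    rcases hl with rfl | rfl
    · exact slack_of (X_ge_w0_R0 n w u (b : ℕ) hu2 hub hbw1 hwn) (hX0g 0 ha0) hT1 hY
    · exact slack_of (X_ge_cn_R0 n w u (b : ℕ) hu2 hub hbw1 hwn) (hX1g 0 ha0) hT1 hY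
  rcases Nat.lt_or_ge (n + 1 - w) (a : ℕ) with hblk | hpl
  · -- block rows `a = (m − w) + jp`
    obtain ⟨jp, hjp⟩ : ∃ jp, (a : ℕ) = (n + 1 - w) + jp := ⟨(a : ℕ) - (n + 1 - w), by omega⟩
    have hjp1 : 1 ≤ jp := by omega
    have hja : (a : ℕ) - (n + 1 - w) = jp := by omega
    rcases Nat.lt_or_ge (jp + 1) u with hjlt | hjge
    · -- bend regime `SX2` (`jp ≤ u − 2`)
      rcases Nat.lt_or_ge 1 (n + 1 - w) with hd2 | hd1
      · have hY : UX n w u a - UX n w u ((perm n w u 1 b : Fin (n + 1)) : ℕ) = ((gG n * thX n w u * ((((n + 1 - w) + (jp)) : ℕ) : ℤ) + SX2 n w u (jp)) - (gG n * thX n w u * ((((n + 1 - w) + ((b : ℕ))) : ℕ) : ℤ) + SXL n w u ((b : ℕ)))) := by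
          rw [hUr]; unfold UX; rw [hja, muX_lt n (by omega), hjp]
        rcases Nat.lt_or_ge (a : ℕ) (u + 1) with hau | hau
        · rcases hl with rfl | rfl
          · exact slack_of (X_ge_w0_Blt2 n w u (b : ℕ) jp ((n + 1 - w)) hjp1 (by omega) (by omega) hub hbw1 (by omega)) (hX0g _ hjp) hT1 hY
          · exact slack_of (X_ge_cn_Blt2 n w u (b : ℕ) jp ((n + 1 - w)) hjp1 (by omega) (by omega) hub hbw1 (by omega)) (hX1g _ hjp) hT1 hY
        · rcases hl with rfl | rfl
          · exact slack_of (X_ge_w0_Blt1 n w u (b : ℕ) jp ((n + 1 - w)) hjp1 (by omega) (by omega) (by omega) hbw1 (by omega)) (hX0g _ hjp) hT1 hY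
          · exact slack_of (X_ge_cn_Blt1 n w u (b : ℕ) jp ((n + 1 - w)) hjp1 (by omega) (by omega) (by omega) hbw1 (by omega)) (hX1g _ hjp) hT1 hY
      · have hnw : n = w := by omega
        have hY : UX n w u a - UX n w u ((perm n w u 1 b : Fin (n + 1)) : ℕ) = ((gG n * thX n w u * (((1 + (jp)) : ℕ) : ℤ) + SX2 n w u (jp)) - (gG n * thX n w u * (((1 + ((b : ℕ))) : ℕ) : ℤ) + SXL n w u ((b : ℕ)))) := by
          rw [hUr]; unfold UX; rw [hja, muX_lt n (by omega), show (a : ℕ) = 1 + jp by omega, show n + 1 - w + (b : ℕ) = 1 + (b : ℕ) by omega]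
        rcases hl with rfl | rfl
        · exact slack_of (X_ge_w0_Blt3 n w u (b : ℕ) jp hjp1 (by omega) hub hbw1 hnw) (hX0g _ (by omega)) hT1 hY
        · exact slack_of (X_ge_cn_Blt3 n w u (b : ℕ) jp hjp1 (by omega) hub hbw1 hnw) (hX1g _ (by omega)) hT1 hY
    · rcases Nat.lt_or_ge (u + 1) jp with hjge2 | hjle
      · -- bend regime `SXL` (`jp ≥ u + 2`)
        have hY : UX n w u a - UX n w u ((perm n w u 1 b : Fin (n + 1)) : ℕ) = ((gG n * thX n w u * ((((n + 1 - w) + (jp)) : ℕ) : ℤ) + SXL n w u (jp)) - (gG n * thX n w u * ((((n + 1 - w) + ((b : ℕ))) : ℕ) : ℤ) + SXL n w u ((b : ℕ)))) := by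
          rw [hUr]; unfold UX; rw [hja, muX_ge n (by omega), hjp]
        rcases hl with rfl | rfl
        · exact slack_of (X_ge_w0_Bge n w u (b : ℕ) jp ((n + 1 - w)) hu2 (by omega) (by omega) (by omega) hbw1 (by omega)) (hX0g _ hjp) hT1 hY
        · exact slack_of (X_ge_cn_Bge n w u (b : ℕ) jp ((n + 1 - w)) hu2 (by omega) (by omega) (by omega) hbw1 (by omega)) (hX1g _ hjp) hT1 hY
      · rcases Nat.lt_or_ge u jp with hjP | hjle2
        · -- `jp = u + 1`: bend `SXP`
          have hju : jp = u + 1 := by omega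
          have hY : UX n w u a - UX n w u ((perm n w u 1 b : Fin (n + 1)) : ℕ) = ((gG n * thX n w (u + 1 - 1) * ((((n + 1 - w) + (jp)) : ℕ) : ℤ) + SXP n w (u + 1 - 1)) - (gG n * thX n w (u + 1 - 1) * ((((n + 1 - w) + ((b : ℕ))) : ℕ) : ℤ) + SXL n w (u + 1 - 1) ((b : ℕ)))) := by
            rw [Nat.add_sub_cancel, hUr]; unfold UX; rw [hja, muX_P' n hju, hjp]
          rcases hl with rfl | rfl
          · have hF := X_ge_w0_BP n w (b : ℕ) jp ((n + 1 - w)) (by omega) (by omega) (by omega) hbw1 (by omega)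
            rw [hju] at hF hY; rw [Nat.add_sub_cancel] at hF hY
            exact slack_of hF (hX0g _ (by omega)) hT1 hY
          · have hF := X_ge_cn_BP n w (b : ℕ) jp ((n + 1 - w)) (by omega) (by omega) (by omega) hbw1 (by omega)
            rw [hju] at hF hY; rw [Nat.add_sub_cancel] at hF hY
            exact slack_of hF (hX1g _ (by omega)) hT1 hY
        · rcases Nat.lt_or_ge jp u with hjR1 | hjR2
          · -- `jp = u − 1`: bend `SXR1`
            have hju : u = jp + 1 := by omega
            subst hju
            have hY : UX n w (jp + 1) a - UX n w (jp + 1) ((perm n w (jp + 1) 1 b : Fin (n + 1)) : ℕ) = ((gG n * thX n w (jp + 1) * ((((n + 1 - w) + (jp)) : ℕ) : ℤ) + SXR1 n w (jp + 1)) - (gG n * thX n w (jp + 1) * ((((n + 1 - w) + ((b : ℕ))) : ℕ) : ℤ) + SXL n w (jp + 1) ((b : ℕ)))) := by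
              rw [hUr]; unfold UX; rw [hja, muX_R1 n rfl, hjp]
            rcases Nat.lt_or_ge 1 (n + 1 - w) with hd2 | hd1
            · rcases hl with rfl | rfl
              · exact slack_of (X_ge_w0_BR1a n w (b : ℕ) jp ((n + 1 - w)) hjp1 (by omega) (by omega) hbw1 (by omega)) (hX0g _ hjp) hT1 hY
              · exact slack_of (X_ge_cn_BR1a n w (b : ℕ) jp ((n + 1 - w)) hjp1 (by omega) (by omega) hbw1 (by omega)) (hX1g _ hjp) hT1 hY
            · have hnw : n = w := by omega
              rw [show n + 1 - w + jp = 1 + jp by omega, show n + 1 - w + (b : ℕ) = 1 + (b : ℕ) by omega] at hY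
              rcases hl with rfl | rfl
              · exact slack_of (X_ge_w0_BR1b n w (b : ℕ) jp hjp1 (by omega) hbw1 hnw) (hX0g _ (by omega)) hT1 hY
              · exact slack_of (X_ge_cn_BR1b n w (b : ℕ) jp hjp1 (by omega) hbw1 hnw) (hX1g _ (by omega)) hT1 hY
          · -- `jp = u`: bend `SXR2`
            have hju : u = jp := by omega
            subst hju
            have hY : UX n w u a - UX n w u ((perm n w u 1 b : Fin (n + 1)) : ℕ) = ((gG n * thX n w u * ((((n + 1 - w) + (u)) : ℕ) : ℤ) + SXR2 n w u) - (gG n * thX n w u * ((((n + 1 - w) + ((b : ℕ))) : ℕ) : ℤ) + SXL n w u ((b : ℕ)))) := by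
              rw [hUr]; unfold UX; rw [hja, muX_R2, hjp]
            rcases hl with rfl | rfl
            · exact slack_of (X_ge_w0_BR2 n w (b : ℕ) u ((n + 1 - w)) hu2 (by omega) (by omega) hbw1 (by omega)) (hX0g _ hjp) hT1 hY
            · exact slack_of (X_ge_cn_BR2 n w (b : ℕ) u ((n + 1 - w)) hu2 (by omega) (by omega) hbw1 (by omega)) (hX1g _ hjp) hT1 hY
  · -- pre-block rows `1 ≤ a ≤ m − w`
    have hY : UX n w u a - UX n w u ((perm n w u 1 b : Fin (n + 1)) : ℕ) = (gG n * thX n w u * (((a) : ℕ) : ℤ) - (gG n * thX n w u * (((n + 1 - w + ((b : ℕ))) : ℕ) : ℤ) + SXL n w u ((b : ℕ)))) := by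
      rw [hUr]; unfold UX; rw [show (a : ℕ) - (n + 1 - w) = 0 by omega, muX_zero n hu2]; simp
    rcases Nat.lt_or_ge (a : ℕ) u with hau | hau
    · rcases hl with rfl | rfl
      · exact slack_of (X_ge_w0_P1 n w u (b : ℕ) a (by omega) (by omega) hub hbw1 (by omega)) (hX0g _ rfl) hT1 hY
      · exact slack_of (X_ge_cn_P1 n w u (b : ℕ) a (by omega) (by omega) hub hbw1 (by omega)) (hX1g _ rfl) hT1 hY
    · rcases Nat.lt_or_ge u (a : ℕ) with hau2 | hau2
      · rcases hl with rfl | rfl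
        · exact slack_of (X_ge_w0_P3 n w u (b : ℕ) a hu2 (by omega) (by omega) hbw1 (by omega)) (hX0g _ rfl) hT1 hY
        · exact slack_of (X_ge_cn_P3 n w u (b : ℕ) a hu2 (by omega) (by omega) hbw1 (by omega)) (hX1g _ rfl) hT1 hY
      · rcases hl with rfl | rfl
        · exact slack_of (X_ge_w0_P2 n w u (b : ℕ) a hu2 (by omega) (by omega) hbw1 (by omega)) (hX0g _ rfl) hT1 hY
        · exact slack_of (X_ge_cn_P2 n w u (b : ℕ) a hu2 (by omega) (by omega) hbw1 (by omega)) (hX1g _ rfl) hT1 hY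

set_option maxHeartbeats 400000 in
/-- slack of the type-X certificate: block columns `b ≥ u + 2`, rival rows from the diagonal to just above the intended row. -/
theorem slackX_ge_mid (w u : ℕ) (hu2 : 2 ≤ u) (huw : u < w) (hwn : w ≤ n) (a b : Fin (n + 1)) (l : Fin 4)
    (hp : ee n a b l ≠ 0) (hub : u + 2 ≤ (b : ℕ)) (hbw : (b : ℕ) < w) (hba : (b : ℕ) ≤ (a : ℕ))
    (haR : (a : ℕ) < (b : ℕ) + (n + 1 - w)) :
    1 * (thX n w u * (dd n l : ℤ) - vv n a b l) <
      UX n w u a + ((thX n w u * (dd n (lam n w u 1 b) : ℤ) - vv n (perm n w u 1 b) b (lam n w u 1 b)) - UX n w u (perm n w u 1 b)) := by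
  have hw1 : w ≤ n + 1 := by omega
  have hbw1 : (b : ℕ) + 1 ≤ w := by omega
  obtain ⟨hr, hlam, hT1, hUr⟩ := interfaceX_ge n w u hu2 huw hwn b hub hbw
  rw [hlam]
  obtain ⟨k, hk⟩ : ∃ k, (a : ℕ) + k = (b : ℕ) + (n + 1 - w) := ⟨(b : ℕ) + (n + 1 - w) - (a : ℕ), by omega⟩
  have hk1 : 1 ≤ k := by omega
  have hkle : k ≤ n + 1 - w := by omega
  have hkle' : k ≤ (b : ℕ) + (n + 1 - w) := by omega
  have hak : (a : ℕ) = (b : ℕ) + (n + 1 - w) - k := by omega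
  -- the class lift to class 1 (future levels) and the level of the rival
  have hXl : ∀ E : ℕ, n + 1 + (b : ℕ) - (a : ℕ) = E → w + 1 ≤ E → l ≠ 0 →
      thX n w u * (dd n l : ℤ) - vv n a b l ≤ thX n w u * d1 n - v1 n E ((b : ℕ)) := by
    intro E hE hwE hcl
    rcases Nat.eq_or_lt_of_le hba with hab | hab
    · have hab' : (a : ℕ) = (b : ℕ) := hab.symm
      have hEm : E = n + 1 := by omega
      have hθ : thX n w u ≤ LL n * ((n : ℤ) + 1) := thX_le_top n huw hwn
      rcases (show l = 0 ∨ l = 1 ∨ l = 2 ∨ l = 3 by fin_cases l <;> simp) with rfl | rfl | rfl | rfl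
      · exact absurd rfl hcl
      · rw [dd_cast_one, vv_diag n hab' 1 (by decide), vblk_one, hEm]
      · rw [dd_cast_two, vv_diag n hab' 2 (by decide), vblk_two, hEm]
        linarith [lift_fut2_top n (θ := thX n w u) ((b : ℕ)) hθ]
      · rw [dd_cast_three, vv_diag n hab' 3 (by decide), vblk_three, hEm]
        linarith [lift_fut3_top n (θ := thX n w u) ((b : ℕ)) hθ]
    · have hne1 : E ≠ n + 1 := by omega
      have hθ : thX n w u ≤ LL n * ((E : ℕ) : ℤ) := thX_le_LE n huw hwn hwE
      rcases (show l = 0 ∨ l = 1 ∨ l = 2 ∨ l = 3 by fin_cases l <;> simp) with rfl | rfl | rfl | rfl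
      · exact absurd rfl hcl
      · rw [dd_cast_one, vv_lower n hab, hE, vblk_one]
      · rw [dd_cast_two, vv_lower n hab, hE, vblk_two, tau2_of_ne n hne1]
        linarith [lift_fut2 n (θ := thX n w u) (E := E) ((b : ℕ)) hθ]
      · rw [dd_cast_three, vv_lower n hab, hE, vblk_three, tau2_of_ne n hne1, tau3_of_ne n hne1]
        linarith [lift_fut3 n (θ := thX n w u) (E := E) ((b : ℕ)) hθ]
  by_cases hcl : l = 0
  · -- the diagonal class-0 cell (a lower cell carries no class 0)
    subst hcl
    rcases Nat.eq_or_lt_of_le hba with hab | hab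
    swap
    · exact absurd (ee_lower_zero n hab) hp
    have hab' : (a : ℕ) = (b : ℕ) := hab.symm
    have hX0 : thX n w u * (dd n 0 : ℤ) - vv n a b 0 = thX n w u * 0 - 0 := by rw [dd_cast_zero, vv_diag_zero n hab']
    have hkq : n + 1 = k + w := by omega
    rcases Nat.lt_or_ge (n + 1 - w) (b : ℕ) with hblk | hpl
    · obtain ⟨jp, hjp⟩ : ∃ jp, (b : ℕ) = (n + 1 - w) + jp := ⟨(b : ℕ) - (n + 1 - w), by omega⟩
      have hjp1 : 1 ≤ jp := by omega
      have hY0 : UX n w u a - UX n w u ((perm n w u 1 b : Fin (n + 1)) : ℕ) =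
          (gG n * thX n w u * ((((n + 1 - w) + (jp)) : ℕ) : ℤ) + muX n w u jp) - (gG n * thX n w u * ((((n + 1 - w) + ((n + 1 - w) + jp)) : ℕ) : ℤ) + SXL n w u ((n + 1 - w) + jp)) := by
        rw [hUr, hab', hjp]; unfold UX; rw [show (n + 1 - w) + jp - (n + 1 - w) = jp by omega]
      rw [hjp] at hT1
      rcases Nat.lt_or_ge (jp + 1) u with hjlt | hjge
      · rw [muX_lt n (by omega)] at hY0
        exact slack_of (X_ge_dg0_Blt n w u jp ((n + 1 - w)) hjp1 (by omega) (by omega) (by omega) (by omega)) hX0 hT1 hY0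
      · rcases Nat.lt_or_ge (u + 1) jp with hjge2 | hjle
        · rw [muX_ge n (by omega)] at hY0
          exact slack_of (X_ge_dg0_Bge n w u jp ((n + 1 - w)) hu2 (by omega) (by omega) (by omega) (by omega)) hX0 hT1 hY0
        · rcases Nat.lt_or_ge u jp with hjP | hjle2
          · have hju : jp = u + 1 := by omega
            rw [muX_P' n hju] at hY0
            have hF := X_ge_dg0_BP n w jp ((n + 1 - w)) (by omega) (by omega) (by omega) (by omega)
            rw [hju] at hF hY0 hT1; rw [Nat.add_sub_cancel] at hF
            exact slack_of hF hX0 hT1 hY0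
          · rcases Nat.lt_or_ge jp u with hjR1 | hjR2
            · have hju : u = jp + 1 := by omega
              subst hju
              rw [muX_R1 n rfl] at hY0
              exact slack_of (X_ge_dg0_BR1 n w jp ((n + 1 - w)) hjp1 (by omega) (by omega) (by omega)) hX0 hT1 hY0
            · have hju : u = jp := by omega
              subst hju
              rw [muX_R2] at hY0
              exact slack_of (X_ge_dg0_BR2 n w u ((n + 1 - w)) hu2 (by omega) (by omega) (by omega)) hX0 hT1 hY0
    · have hY : UX n w u a - UX n w u ((perm n w u 1 b : Fin (n + 1)) : ℕ) = (gG n * thX n w u * ((((b : ℕ)) : ℕ) : ℤ) - (gG n * thX n w u * (((n + 1 - w + ((b : ℕ))) : ℕ) : ℤ) + SXL n w u ((b : ℕ)))) := by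
        rw [hUr, hab']; unfold UX; rw [show (b : ℕ) - (n + 1 - w) = 0 by omega, muX_zero n hu2]; simp
      exact slack_of (X_ge_dg0_P n w u (b : ℕ) hu2 hub hbw1 (by omega)) hX0 hT1 hY
  -- classes 1, 2, 3: reduce to class 1 at the rival's (future) level `w + k`
  have hlev : n + 1 + (b : ℕ) - (a : ℕ) = w + k := by omega
  have hXl := hXl (w + k) hlev (by omega) hcl
  rcases Nat.lt_or_ge (b : ℕ) k with hkb | hkb
  · -- pre-block rival row
    have hY : UX n w u a - UX n w u ((perm n w u 1 b : Fin (n + 1)) : ℕ) = (gG n * thX n w u * (((n + 1 - w + (b : ℕ) - k) : ℕ) : ℤ) - (gG n * thX n w u * (((n + 1 - w + ((b : ℕ))) : ℕ) : ℤ) + SXL n w u ((b : ℕ)))) := by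
      rw [hUr]; unfold UX; rw [show (a : ℕ) - (n + 1 - w) = 0 by omega, muX_zero n hu2, show (a : ℕ) = n + 1 - w + (b : ℕ) - k by omega]; ring
    rcases Nat.lt_or_ge (k + w) (n + 1) with hlt | hm
    · exact slack_le (X_ge_up_Pl_lt n w u (b : ℕ) k hu2 hub (by omega) hbw1 (by omega)) hXl hT1 hY
    · have hkq : n + 1 = k + w := by omega
      rw [show w + k = n + 1 by omega] at hXl
      exact slack_le (X_ge_up_Pl_m n w u (b : ℕ) k hu2 hub (by omega) hbw1 hkq) hXl hT1 hY
  · -- block rival row with bend index `s = b − k`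
    have hja : (a : ℕ) - (n + 1 - w) = (b : ℕ) - k := by omega
    rcases Nat.lt_or_ge ((b : ℕ) - k + 1) u with hslt | hsge
    · -- `s ≤ u − 2`: bend `SX2`
      obtain ⟨s, hs⟩ : ∃ s, (b : ℕ) - k = s := ⟨_, rfl⟩
      have hks : k = (b : ℕ) - s := by omega
      have hY : UX n w u a - UX n w u ((perm n w u 1 b : Fin (n + 1)) : ℕ) = ((-(gG n * thX n w u * ((((b : ℕ) - s) : ℕ) : ℤ))) + (SX2 n w u (s) - SXL n w u ((b : ℕ)))) := by
        rw [hUr]; unfold UX; rw [hja, muX_lt n (by omega), hak, hs]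
        push_cast [Nat.cast_sub hkle', Nat.cast_sub hw1, Nat.cast_sub (show s ≤ (b : ℕ) by omega)]; rw [hks]; push_cast [Nat.cast_sub (show s ≤ (b : ℕ) by omega)]; ring
      rw [hks] at hXl
      rcases Nat.lt_or_ge (((b : ℕ) - s) + w) (n + 1) with hlt | hm
      · exact slack_le (X_ge_up_A_lt n w u (b : ℕ) s (by omega) hub hbw1 (by omega)) hXl hT1 hY
      · rw [show w + ((b : ℕ) - s) = n + 1 by omega] at hXl
        exact slack_le (X_ge_up_A_m n w u (b : ℕ) s (by omega) hub hbw1 (by omega)) hXl hT1 hY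
    · rcases Nat.lt_or_ge (u + 1) ((b : ℕ) - k) with hsE | hsle
      · -- `s ≥ u + 2`: bend `SXL`
        have hY : UX n w u a - UX n w u ((perm n w u 1 b : Fin (n + 1)) : ℕ) = ((-(gG n * thX n w u * ((k : ℕ) : ℤ))) + (SXL n w u ((b : ℕ) - k) - SXL n w u ((b : ℕ)))) := by
          rw [hUr]; unfold UX; rw [hja, muX_ge n (by omega), hak]; push_cast [Nat.cast_sub hkle', Nat.cast_sub hw1]; ring
        rcases Nat.lt_or_ge (k + w) (n + 1) with hlt | hm
        · exact slack_le (X_ge_up_E_lt n w u (b : ℕ) k hu2 hk1 (by omega) hbw1 (by omega)) hXl hT1 hY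
        · rw [show w + k = n + 1 by omega] at hXl
          exact slack_le (X_ge_up_E_m n w u (b : ℕ) k hu2 hk1 (by omega) hbw1 (by omega)) hXl hT1 hY
      · rcases Nat.lt_or_ge u ((b : ℕ) - k) with hsP | hsle2
        · -- `s = u + 1`: bend `SXP`
          have hkv : k = (b : ℕ) - u - 1 := by omega
          subst hkv
          have hY : UX n w u a - UX n w u ((perm n w u 1 b : Fin (n + 1)) : ℕ) = ((-(gG n * thX n w u * ((((b : ℕ) - u - 1) : ℕ) : ℤ))) + (SXP n w u - SXL n w u ((b : ℕ)))) := by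
            rw [hUr]; unfold UX; rw [hja, muX_P' n (by omega), hak]; push_cast [Nat.cast_sub hkle', Nat.cast_sub hw1]; ring
          rcases Nat.lt_or_ge (((b : ℕ) - u - 1) + w) (n + 1) with hlt | hm
          · exact slack_le (X_ge_up_P_lt n w u (b : ℕ) hu2 hub hbw1 (by omega)) hXl hT1 hY
          · rw [show w + ((b : ℕ) - u - 1) = n + 1 by omega] at hXl
            exact slack_le (X_ge_up_P_m n w u (b : ℕ) hu2 hub hbw1 (by omega)) hXl hT1 hY
        · rcases Nat.lt_or_ge ((b : ℕ) - k) u with hsR1 | hsR2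
          · -- `s = u − 1`: bend `SXR1`
            have hkv : k = (b : ℕ) - u + 1 := by omega
            subst hkv
            have hY : UX n w u a - UX n w u ((perm n w u 1 b : Fin (n + 1)) : ℕ) = ((-(gG n * thX n w u * ((((b : ℕ) - u + 1) : ℕ) : ℤ))) + (SXR1 n w u - SXL n w u ((b : ℕ)))) := by
              rw [hUr]; unfold UX; rw [hja, muX_R1 n (by omega), hak]; push_cast [Nat.cast_sub hkle', Nat.cast_sub hw1, Nat.cast_sub (show u ≤ (b : ℕ) by omega)]; ring
            rcases Nat.lt_or_ge (((b : ℕ) - u + 1) + w) (n + 1) with hlt | hm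
            · exact slack_le (X_ge_up_R1_lt n w u (b : ℕ) hu2 hub hbw1 (by omega)) hXl hT1 hY
            · rw [show w + ((b : ℕ) - u + 1) = n + 1 by omega] at hXl
              exact slack_le (X_ge_up_R1_m n w u (b : ℕ) hu2 hub hbw1 (by omega)) hXl hT1 hY
          · -- `s = u`: bend `SXR2`
            have hkv : k = (b : ℕ) - u := by omega
            subst hkv
            have hY : UX n w u a - UX n w u ((perm n w u 1 b : Fin (n + 1)) : ℕ) = ((-(gG n * thX n w u * ((((b : ℕ) - u) : ℕ) : ℤ))) + (SXR2 n w u - SXL n w u ((b : ℕ)))) := by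
              rw [hUr]; unfold UX; rw [hja, show (b : ℕ) - ((b : ℕ) - u) = u by omega, muX_R2, hak]; push_cast [Nat.cast_sub hkle', Nat.cast_sub hw1, Nat.cast_sub (show u ≤ (b : ℕ) by omega)]; ring
            rcases Nat.lt_or_ge (((b : ℕ) - u) + w) (n + 1) with hlt | hm
            · exact slack_le (X_ge_up_R2_lt n w u (b : ℕ) hu2 hub hbw1 (by omega)) hXl hT1 hY
            · rw [show w + ((b : ℕ) - u) = n + 1 by omega] at hXl
              exact slack_le (X_ge_up_R2_m n w u (b : ℕ) hu2 hub hbw1 (by omega)) hXl hT1 hY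

set_option maxHeartbeats 400000 in
/-- slack of the type-X certificate: block columns `b ≥ u + 2`, rival rows at or below the intended row. -/
theorem slackX_ge_lo (w u : ℕ) (hu2 : 2 ≤ u) (huw : u < w) (hwn : w ≤ n) (a b : Fin (n + 1)) (l : Fin 4)
    (hp : ee n a b l ≠ 0) (hne : perm n w u 1 b ≠ a ∨ lam n w u 1 b ≠ l) (hub : u + 2 ≤ (b : ℕ)) (hbw : (b : ℕ) < w)
    (haR : (b : ℕ) + (n + 1 - w) ≤ (a : ℕ)) :
    1 * (thX n w u * (dd n l : ℤ) - vv n a b l) <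
      UX n w u a + ((thX n w u * (dd n (lam n w u 1 b) : ℤ) - vv n (perm n w u 1 b) b (lam n w u 1 b)) - UX n w u (perm n w u 1 b)) := by
  have hw1 : w ≤ n + 1 := by omega
  have hbw1 : (b : ℕ) + 1 ≤ w := by omega
  have han : (a : ℕ) ≤ n := Nat.lt_succ_iff.mp a.isLt
  obtain ⟨hr, hlam, hT1, hUr⟩ := interfaceX_ge n w u hu2 huw hwn b hub hbw
  rw [hlam] at hne ⊢
  have hlow : (b : ℕ) < (a : ℕ) := by omega
  have hcl : l ≠ 0 := fun h0 => by subst h0; exact hp (ee_lower_zero n hlow)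
  have hwne : w ≠ n + 1 := by omega
  rcases Nat.eq_or_lt_of_le haR with haR1 | hagt
  · -- class rivals at the intended cell (level `w`)
    have hrot : perm n w u 1 b = a := Fin.ext (by rw [hr]; omega)
    have hY : UX n w u a - UX n w u ((perm n w u 1 b : Fin (n + 1)) : ℕ) = 0 := by rw [hrot]; ring
    have hEa : n + 1 + (b : ℕ) - (a : ℕ) = w := by omega
    rcases (show l = 0 ∨ l = 1 ∨ l = 2 ∨ l = 3 by fin_cases l <;> simp) with rfl | rfl | rfl | rfl
    · exact absurd rfl hcl
    · exact absurd rfl (hne.resolve_left (fun h => h hrot))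
    · have hX : thX n w u * (dd n 2 : ℤ) - vv n a b 2 = thX n w u * d2 n - (v1 n (w) ((b : ℕ)) + bB n * tau2lt n (w) ((b : ℕ))) := by
        rw [dd_cast_two, vv_lower n hlow, hEa, vblk_two, tau2_of_ne n hwne]
      exact slack_of0 (X_ge_cls_l2 n w u (b : ℕ) hu2 hub hbw1 hwn) hX hT1 hY
    · have hX : thX n w u * (dd n 3 : ℤ) - vv n a b 3 = thX n w u * d3 n - ((v1 n (w) ((b : ℕ)) + bB n * tau2lt n (w) ((b : ℕ))) + tau3lt n (w) ((b : ℕ))) := by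
        rw [dd_cast_three, vv_lower n hlow, hEa, vblk_three, tau2_of_ne n hwne, tau3_of_ne n hwne]
      exact slack_of0 (X_ge_cls_l3 n w u (b : ℕ) hu2 hub hbw1 hwn) hX hT1 hY
  · -- below the intended cell: past levels `w − k`, class 3 best
    obtain ⟨k, hk⟩ : ∃ k, (a : ℕ) = ((b : ℕ) + (n + 1 - w)) + k := ⟨(a : ℕ) - ((b : ℕ) + (n + 1 - w)), by omega⟩
    have hk1 : 1 ≤ k := by clear hT1 hUr hr; omega
    have hkw : ((b : ℕ) + k) + 1 ≤ w := by clear hT1 hUr hr; omega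
    have hEa : n + 1 + (b : ℕ) - (a : ℕ) = w - k := by clear hT1 hUr hr; omega
    have hne3 : w - k ≠ n + 1 := by clear hT1 hUr hr hEa; omega
    have hcn : (b : ℕ) ≤ n := by clear hT1 hUr hr hEa hne3; omega
    have hEn : w - k ≤ n := by clear hT1 hUr hr hEa hne3; omega
    have hj : (a : ℕ) - (n + 1 - w) = (b : ℕ) + k := by clear hT1 hUr hr hEa hne3 hcn hEn; omega
    have huk : u + 2 ≤ (b : ℕ) + k := by clear hT1 hUr hr hEa hne3 hcn hEn hj; omega
    have hθ : LL n * ((w - k : ℕ) + 1) ≤ thX n w u :=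
      LE_le_thX n u (by clear hT1 hUr hr hEa hne3 hcn hEn hj; omega)
    have hX3 : thX n w u * (dd n 3 : ℤ) - vv n a b 3 = thX n w u * d3 n - ((v1 n (w - k) ((b : ℕ)) + bB n * tau2lt n (w - k) ((b : ℕ))) + tau3lt n (w - k) ((b : ℕ))) := by
      rw [dd_cast_three, vv_lower n hlow, hEa, vblk_three, tau2_of_ne n hne3, tau3_of_ne n hne3]
    have hlift : thX n w u * (dd n l : ℤ) - vv n a b l + (if l = 3 then 0 else 1) ≤ thX n w u * d3 n - ((v1 n (w - k) ((b : ℕ)) + bB n * tau2lt n (w - k) ((b : ℕ))) + tau3lt n (w - k) ((b : ℕ))) := by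
      rcases (show l = 0 ∨ l = 1 ∨ l = 2 ∨ l = 3 by fin_cases l <;> simp) with rfl | rfl | rfl | rfl
      · exact absurd rfl hcl
      · rw [dd_cast_one, vv_lower n hlow, hEa, vblk_one]
        simp only [show ((1 : Fin 4) = 3) = False by decide, ite_false]
        linarith [lift_past1 n (θ := thX n w u) (c := (b : ℕ)) (E := w - k) hcn hEn hθ]
      · rw [dd_cast_two, vv_lower n hlow, hEa, vblk_two, tau2_of_ne n hne3]
        simp only [show ((2 : Fin 4) = 3) = False by decide, ite_false]
        linarith [lift_past2 n (θ := thX n w u) (c := (b : ℕ)) (E := w - k) hcn hEn hθ]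
      · rw [hX3]; simp
    clear hX3 hEa hne3 hcn hEn hθ
    have hY : UX n w u a - UX n w u ((perm n w u 1 b : Fin (n + 1)) : ℕ) = (gG n * thX n w u * ((k : ℕ) : ℤ) + (SXL n w u ((b : ℕ) + k) - SXL n w u ((b : ℕ)))) := by
      rw [hUr]; unfold UX; rw [hj, muX_ge n huk, hk]; push_cast [Nat.cast_sub hw1]; ring
    have hF := X_ge_down n w u (b : ℕ) k hu2 hub hk1 hkw hwn
    exact slack_of (lift_combine hlift hF) rfl hT1 hY

/-- slack of the type-X certificate: the block columns `u + 2 ≤ b < w`. -/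
theorem slackX_ge (w u : ℕ) (hu2 : 2 ≤ u) (huw : u < w) (hwn : w ≤ n) (a b : Fin (n + 1)) (l : Fin 4)
    (hp : ee n a b l ≠ 0) (hne : perm n w u 1 b ≠ a ∨ lam n w u 1 b ≠ l) (hub : u + 2 ≤ (b : ℕ)) (hbw : (b : ℕ) < w) :
    1 * (thX n w u * (dd n l : ℤ) - vv n a b l) <
      UX n w u a + ((thX n w u * (dd n (lam n w u 1 b) : ℤ) - vv n (perm n w u 1 b) b (lam n w u 1 b)) - UX n w u (perm n w u 1 b)) := by
  rcases Nat.lt_or_ge (a : ℕ) (b : ℕ) with hab | hba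
  · exact slackX_ge_up n w u hu2 huw hwn a b l hp hub hbw hab
  · rcases Nat.lt_or_ge (a : ℕ) ((b : ℕ) + (n + 1 - w)) with h | h
    · exact slackX_ge_mid n w u hu2 huw hwn a b l hp hub hbw hba h
    · exact slackX_ge_lo n w u hu2 huw hwn a b l hp hne hub hbw h

end GradedWalk

end Summit.ValiantsHypothesis.ValiantsHypothesis.Theorems.LacunarySymmetroidMatrixDescartes.TropicalCensus
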